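import Literature.RepresentationTheory.HeisenbergGroup.SymplecticPiBigCell
import Literature.NumberTheory.Weil1964.LocalLerayCocycleParabolic
import HarnessLib

/-!
# The Leray cocycle of `Sp(F^ι ⊕ F^ι)` on the big cell: `c_{ℓ_Y}(w n(S), w) = γ_{ψ₂}(-½⟨x, Sx⟩)` and the reduction
# `c_{ℓ_Y}(g₁, g₂) = c_{ℓ_Y}(w n(T), w)`

Topic `NumberTheory/Weil1964`; namespace `Literature.NumberTheory.Weil1964`. KERNEL mathematics only (theorems + one
private coordinate isomorphism; no named fact, no `axiom`, no `sorry`).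

The rank-`n` companion of `LocalLerayCocycleSL2.lean`: `W = F^ι ⊕ F^ι` with Weil's form
`A = alt (polar (dotProductBilin F F))`, the Lagrangian `ℓ_Y = 0 ⊕ F^ι`, Weil's generators `n(c), m(a), w` of
`Sp(W)` (`SymplecticPiBigCell.lean`), `ψ` a non-trivial continuous character of the non-archimedean local field `F`
(`2` invertible), `μ` a Haar measure, `c_{ℓ_Y}(g₁, g₂) = γ_ψ(τ(ℓ_Y, g₁ℓ_Y, g₁g₂ℓ_Y))` the tree's `lerayCocycle`.

* §1 dilating the character: `γ'_ψ(a·Q) = γ'_{ψ_a}(Q)` (`weilIndexQF'_smul`), `ψ_a = ψ(a·)` again non-trivial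
  continuous ([Weil1964] Chap. I n° 14: `γ` is attached to the character of second degree `ψ ∘ Q`).
* §2 **the value on the Weyl–unipotent pair** ([Rangarao1993] Thm 4.1 (4) "`c(τ u_ρ, τ) =` Weil index of
  `χ(½⟨x, xρ⟩)`", [LionVergne1980] 1.5.4): for `S` symmetric invertible the three Lagrangians are
  `ℓ_Y`, `w n(S) ℓ_Y = F^ι ⊕ 0`, `w n(S) w ℓ_Y = {(Sy, -y)}`, pairwise transverse, the transverse form on the middle
  one is `x ↦ -⟨x, S⁻¹x⟩ ≅ x ↦ -⟨x, Sx⟩ = 2 · (-½⟨x, Sx⟩)`, whence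
  **`c_{ℓ_Y}^ψ(w n(S), w) = γ'_ψ(-⟨x, Sx⟩) = γ_{ψ₂}(-½⟨x, Sx⟩)`**, `ψ₂ = ψ(2·)`
  (`lerayCocycle_weyl_unipotent`); equivalently `c_{ℓ_Y}^{ψ(½·)}(w n(S), w) = γ_ψ(-½⟨x,Sx⟩)` — the `½` of Rao's /
  MVW's "`γ(ψ ∘ ½ q)`".
* §3 **reduction to that pair by bi-`P`-invariance** ([Rangarao1993] Thm 4.1 (1)): for canonical words
  `gᵢ = n(γᵢ) m(Bᵢ) w n(δᵢ)` and `T = ᵗB₂(δ₁ + γ₂)B₂`, `c_{ℓ_Y}(g₁, g₂) = c_{ℓ_Y}(w n(T), w)`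
  (`lerayCocycle_canonicalWord`), since `w n(δ₁) n(γ₂) m(B₂) = m(ᵗB₂⁻¹) w n(T)`.

## References

* [Rangarao1993] R. Ranga Rao, Pacific J. Math. 157 (1993): Thm 4.1 (1), (4), (5), p. 358; Def. 2.4 p. 339.
* [LionVergne1980] G. Lion, M. Vergne, *The Weil representation, Maslov index and Theta series*, PM 6 (1980), §1.5.4,
  §1.6.13.
* [Weil1964] A. Weil, Acta Math. 111 (1964): Chap. I n° 14, n° 15 Thm 3.
-/

set_option autoImplicit false

noncomputable section

namespace Literature.NumberTheory.Weil1964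

open _root_.MeasureTheory Matrix Filter
open Literature.RepresentationTheory.HeisenbergGroup
open Literature.NumberTheory.Automorphic
open Literature.NumberTheory.GaloisRepresentations.IsNonarchimedeanLocalField
open Literature.LinearAlgebra.QuadraticForm

/-! ## §1 Dilating the character: `γ_ψ(a·Q) = γ_{ψ_a}(Q)` -/

section Dilation

variable {F : Type*} [Field F] [ValuativeRel F] [TopologicalSpace F] [IsNonarchimedeanLocalField F]
  {ι : Type*} [Fintype ι] [MeasurableSpace F] [BorelSpace F] (μ : Measure F) [μ.IsAddHaarMeasure]
  {ψ : AddChar F Circle}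

omit [MeasurableSpace F] [BorelSpace F] in
/-- `ψ_a = ψ(a·)` is again continuous and non-trivial for `a ≠ 0`. [cite: Weil1964, Chap. I n° 14, p. 161] -/
theorem isContinuousNontrivial_mulShift_of_ne_zero (hψ : ψ.IsContinuousNontrivial) {a : F} (ha : a ≠ 0) :
    (ψ.mulShift a).IsContinuousNontrivial := by
  -- TODO(dedupe): same statement as `Automorphic.isContinuousNontrivial_mulShift` (GL2KirillovInjective) for units.
  refine ⟨?_, fun h => hψ.2 ?_⟩
  · change Continuous fun x => ψ.mulShift a x
    simp only [AddChar.mulShift_apply]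
    exact hψ.1.comp (continuous_const.mul continuous_id)
  · refine DFunLike.ext _ _ fun x => ?_
    have hx := DFunLike.congr_fun h (a⁻¹ * x)
    rwa [AddChar.mulShift_apply, mul_inv_cancel_left₀ ha] at hx

omit [ValuativeRel F] [TopologicalSpace F] [IsNonarchimedeanLocalField F] [BorelSpace F] [μ.IsAddHaarMeasure] in
/-- `g_ψ(a·Q, D) = g_{ψ_a}(Q, D)`. [cite: Weil1964, Chap. I n° 14, p. 161] -/
theorem gaussQF_smul (a : F) (Q : QuadraticForm F (ι → F)) (D : Set (ι → F)) :
    gaussQF ψ μ (a • Q) D = gaussQF (ψ.mulShift a) μ Q D := by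
  rw [gaussQF_def, gaussQF_def]
  refine integral_congr_ae (Eventually.of_forall fun x => ?_)
  rw [psiQF_apply, psiQF_apply, QuadraticMap.smul_apply, AddChar.mulShift_apply, smul_eq_mul]

omit [BorelSpace F] [μ.IsAddHaarMeasure] in
/-- `g_ψ(a·Q) = g_{ψ_a}(Q)` for the stable values. [cite: Weil1964, Chap. I n° 14, p. 161] -/
theorem weilGaussQF_smul (a : F) (Q : QuadraticForm F (ι → F)) :
    weilGaussQF ψ μ (a • Q) = weilGaussQF (ψ.mulShift a) μ Q := by
  simp only [weilGaussQF, gaussQF_smul]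

omit [BorelSpace F] [μ.IsAddHaarMeasure] in
/-- `γ_ψ(a·Q) = γ_{ψ_a}(Q)` (non-degenerate index). [cite: Weil1964, Chap. I n° 14, p. 161] -/
theorem weilIndexQF_smul (a : F) (Q : QuadraticForm F (ι → F)) :
    weilIndexQF ψ μ (a • Q) = weilIndexQF (ψ.mulShift a) μ Q := by
  rw [weilIndexQF_def, weilIndexQF_def, weilGaussQF_smul]

omit [ValuativeRel F] [TopologicalSpace F] [IsNonarchimedeanLocalField F] [Fintype ι] [MeasurableSpace F]
  [BorelSpace F] [μ.IsAddHaarMeasure] in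
/-- `a·Q` is non-degenerate with `Q` (`a ≠ 0`). [cite: Weil1964, Chap. I n° 14, p. 161] -/
theorem separatingLeft_associated_smul [Invertible (2 : F)] {V : Type*} [AddCommGroup V] [Module F V]
    {Q : QuadraticForm F V} (hQ : (QuadraticMap.associated (R := F) Q).SeparatingLeft) {a : F} (ha : a ≠ 0) :
    (QuadraticMap.associated (R := F) (a • Q)).SeparatingLeft := fun x hx => hQ x fun y => by
  have := hx y
  rw [map_smul, LinearMap.smul_apply, LinearMap.smul_apply, smul_eq_mul, mul_eq_zero] at this
  exact this.resolve_left ha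

/-- **`γ'_ψ(a·Q) = γ'_{ψ_a}(Q)`** for a non-degenerate `Q` and `a ≠ 0`. [cite: Weil1964, Chap. I n° 14, p. 161] -/
theorem weilIndexQF'_smul [Invertible (2 : F)] (hψ : ψ.IsContinuousNontrivial) {a : F} (ha : a ≠ 0)
    {Q : QuadraticForm F (ι → F)} (hQ : (QuadraticMap.associated (R := F) Q).SeparatingLeft) :
    weilIndexQF' ψ μ (a • Q) = weilIndexQF' (ψ.mulShift a) μ Q := by
  rw [weilIndexQF'_eq_weilIndexQF μ hψ (separatingLeft_associated_smul hQ ha),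
    weilIndexQF'_eq_weilIndexQF μ (isContinuousNontrivial_mulShift_of_ne_zero hψ ha) hQ, weilIndexQF_smul]

end Dilation

/-! ## §2 The value `c_{ℓ_Y}(w n(S), w)` -/

section Value

variable {F : Type*} [Field F] [ValuativeRel F] [TopologicalSpace F] [IsNonarchimedeanLocalField F]
  {ι : Type*} [Fintype ι] [Invertible (2 : F)]
  [MeasurableSpace F] [BorelSpace F] (μ : Measure F) [μ.IsAddHaarMeasure] {ψ : AddChar F Circle}

local notation "𝕍" => ((ι → F) × (ι → F))
local notation "Spι" => (symplecticGroup (polar (dotProductBilin F F (m := ι))))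
local notation "ℓY" => (Submodule.prod (⊥ : Submodule F (ι → F)) (⊤ : Submodule F (ι → F)))
local notation "𝔸" => (alt (polar (dotProductBilin F F (m := ι))))
local notation "𝐧" => unipotentSp (dotProductBilin F F (m := ι))
local notation "𝐦" a:max => leviSp (dotProductBilin F F (m := ι)) a (dualLeviPi a) (dotProductBilin_apply_dualLeviPi a)
local notation "𝐰" => weylSp (dotProductBilin F F (m := ι)) (LinearEquiv.refl F (ι → F)) (LinearEquiv.neg F)
  dotProductBilin_refl_neg'

omit [ValuativeRel F] [TopologicalSpace F] [IsNonarchimedeanLocalField F] [MeasurableSpace F] [BorelSpace F] in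
/-- `w n(S)` maps `(0, y)` to `(y, 0)`: `w n(S) ℓ_Y = F^ι ⊕ 0`. [cite: Rangarao1993, Thm 4.1 (4), p. 358] -/
theorem weyl_unipotent_apply_inr (S : (ι → F) →ₗ[F] (ι → F))
    (hS : ∀ x x' : ι → F, dotProductBilin F F x (S x') = dotProductBilin F F x' (S x)) (y : ι → F) :
    ((𝐰 * 𝐧 S hS : Spι) : 𝕍 ≃ₗ[F] 𝕍) (0, y) = (y, 0) := by
  simp [LinearEquiv.mul_apply, coe_weylSp]

omit [ValuativeRel F] [TopologicalSpace F] [IsNonarchimedeanLocalField F] [MeasurableSpace F] [BorelSpace F] in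
/-- `w n(S) w` maps `(0, y)` to `(Sy, -y)`: `w n(S) w ℓ_Y = {(Sy, -y)}`. [cite: Rangarao1993, Thm 4.1 (4), p. 358] -/
theorem weyl_unipotent_weyl_apply_inr (S : (ι → F) →ₗ[F] (ι → F))
    (hS : ∀ x x' : ι → F, dotProductBilin F F x (S x') = dotProductBilin F F x' (S x)) (y : ι → F) :
    ((𝐰 * 𝐧 S hS * 𝐰 : Spι) : 𝕍 ≃ₗ[F] 𝕍) (0, y) = (S y, -y) := by
  simp [LinearEquiv.mul_apply, coe_weylSp]

omit [ValuativeRel F] [TopologicalSpace F] [IsNonarchimedeanLocalField F] [MeasurableSpace F] [BorelSpace F] in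
/-- membership in `w n(S) ℓ_Y = F^ι ⊕ 0`. [cite: Rangarao1993, Thm 4.1 (4), p. 358] -/
theorem mem_map_weyl_unipotent_iff (S : (ι → F) →ₗ[F] (ι → F))
    (hS : ∀ x x' : ι → F, dotProductBilin F F x (S x') = dotProductBilin F F x' (S x)) (v : 𝕍) :
    v ∈ Submodule.map (((𝐰 * 𝐧 S hS : Spι) : 𝕍 ≃ₗ[F] 𝕍) : 𝕍 →ₗ[F] 𝕍) ℓY ↔ v.2 = 0 := by
  rw [Submodule.mem_map]
  constructor
  · rintro ⟨u, hu, rfl⟩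
    rw [mem_prod_bot_top_iff] at hu
    rw [show u = (0, u.2) from Prod.ext hu rfl, LinearEquiv.coe_coe, weyl_unipotent_apply_inr]
  · intro hv
    refine ⟨(0, v.1), (mem_prod_bot_top_iff _).2 rfl, ?_⟩
    rw [LinearEquiv.coe_coe, weyl_unipotent_apply_inr]
    exact Prod.ext rfl hv.symm

omit [ValuativeRel F] [TopologicalSpace F] [IsNonarchimedeanLocalField F] [MeasurableSpace F] [BorelSpace F] in
/-- `(Sy, -y) ∈ w n(S) w ℓ_Y`. [cite: Rangarao1993, Thm 4.1 (4), p. 358] -/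
theorem mem_map_weyl_unipotent_weyl (S : (ι → F) →ₗ[F] (ι → F))
    (hS : ∀ x x' : ι → F, dotProductBilin F F x (S x') = dotProductBilin F F x' (S x)) (y : ι → F) :
    ((S y, -y) : 𝕍) ∈ Submodule.map (((𝐰 * 𝐧 S hS * 𝐰 : Spι) : 𝕍 ≃ₗ[F] 𝕍) : 𝕍 →ₗ[F] 𝕍) ℓY :=
  ⟨(0, y), (mem_prod_bot_top_iff _).2 rfl, by rw [LinearEquiv.coe_coe, weyl_unipotent_weyl_apply_inr]⟩

omit [ValuativeRel F] [TopologicalSpace F] [IsNonarchimedeanLocalField F] [MeasurableSpace F] [BorelSpace F] in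
/-- **`ℓ_Y` and `w n(S) w ℓ_Y` are transverse for `S` invertible** (`w n(S) w` lies in the big cell, its `B`-block
being `S`). [cite: Rangarao1993, Thm 4.1 (4), p. 358] -/
theorem isCompl_prod_bot_top_map_weyl_unipotent_weyl (S : (ι → F) ≃ₗ[F] (ι → F))
    (hS : ∀ x x' : ι → F, dotProductBilin F F x (S x') = dotProductBilin F F x' (S x)) :
    IsCompl ℓY (Submodule.map (((𝐰 * 𝐧 (S : (ι → F) →ₗ[F] (ι → F)) hS * 𝐰 : Spι) : 𝕍 ≃ₗ[F] 𝕍) :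
      𝕍 →ₗ[F] 𝕍) ℓY) := by
  have hB : Function.Bijective (blockB ((𝐰 * 𝐧 (S : (ι → F) →ₗ[F] (ι → F)) hS * 𝐰 : Spι) : 𝕍 ≃ₗ[F] 𝕍)) := by
    have : blockB ((𝐰 * 𝐧 (S : (ι → F) →ₗ[F] (ι → F)) hS * 𝐰 : Spι) : 𝕍 ≃ₗ[F] 𝕍) =
        (S : (ι → F) →ₗ[F] (ι → F)) := by
      ext y; rw [blockB_apply, weyl_unipotent_weyl_apply_inr]
    rw [this]; exact S.bijective
  have h : IsCompl (Submodule.map (((𝐰 * 𝐧 (S : (ι → F) →ₗ[F] (ι → F)) hS * 𝐰 : Spι) : 𝕍 ≃ₗ[F] 𝕍) :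
      𝕍 →ₗ[F] 𝕍) ℓY) ℓY := mem_bigCell_of_blockB_bijective _ hB
  exact h.symm

omit [ValuativeRel F] [TopologicalSpace F] [IsNonarchimedeanLocalField F] [MeasurableSpace F] [BorelSpace F] in
/-- the middle plane `w n(S) ℓ_Y = F^ι ⊕ 0` in coordinates: `x ↦ (x, 0)`. [cite: LionVergne1980, §1.5.4] -/
private def middleCoord (S : (ι → F) →ₗ[F] (ι → F))
    (hS : ∀ x x' : ι → F, dotProductBilin F F x (S x') = dotProductBilin F F x' (S x)) :
    (ι → F) ≃ₗ[F] Submodule.map (((𝐰 * 𝐧 S hS : Spι) : 𝕍 ≃ₗ[F] 𝕍) : 𝕍 →ₗ[F] 𝕍) ℓY where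
  toFun x := ⟨(x, 0), (mem_map_weyl_unipotent_iff S hS _).2 rfl⟩
  map_add' _ _ := Subtype.ext (Prod.ext rfl (add_zero _).symm)
  map_smul' _ _ := Subtype.ext (Prod.ext rfl (smul_zero _).symm)
  invFun v := (v : 𝕍).1
  left_inv _ := rfl
  right_inv v := Subtype.ext (Prod.ext rfl ((mem_map_weyl_unipotent_iff S hS _).1 v.2).symm)

omit [ValuativeRel F] [TopologicalSpace F] [IsNonarchimedeanLocalField F] [MeasurableSpace F] [BorelSpace F] in
/-- **the transverse form of the triple `(ℓ_Y, w n(S)ℓ_Y, w n(S) w ℓ_Y)` is `x ↦ -⟨x, S⁻¹x⟩`** on `F^ι ≅ F^ι ⊕ 0`: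
`(x, 0) = (0, S⁻¹x) + (x, -S⁻¹x)` with `(0, S⁻¹x) ∈ ℓ_Y`, `(x, -S⁻¹x) = (S y, -y)` for `y = S⁻¹x`, and
`A((0, S⁻¹x), (x, -S⁻¹x)) = -⟨x, S⁻¹x⟩`. [cite: LionVergne1980, §1.5.4; Rangarao1993, Def. 2.4, Thm 4.1 (4)] -/
theorem transverseForm_weyl_unipotent (S : (ι → F) ≃ₗ[F] (ι → F))
    (hS : ∀ x x' : ι → F, dotProductBilin F F x (S x') = dotProductBilin F F x' (S x)) (x : ι → F) :
    transverseForm 𝔸 ℓY (Submodule.map (((𝐰 * 𝐧 (S : (ι → F) →ₗ[F] (ι → F)) hS : Spι) : 𝕍 ≃ₗ[F] 𝕍) :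
        𝕍 →ₗ[F] 𝕍) ℓY)
      (Submodule.map (((𝐰 * 𝐧 (S : (ι → F) →ₗ[F] (ι → F)) hS * 𝐰 : Spι) : 𝕍 ≃ₗ[F] 𝕍) : 𝕍 →ₗ[F] 𝕍) ℓY)
      (isCompl_prod_bot_top_map_weyl_unipotent_weyl S hS) (middleCoord (S : (ι → F) →ₗ[F] (ι → F)) hS x) =
      -(x ⬝ᵥ S.symm x) := by
  have h := isCompl_prod_bot_top_map_weyl_unipotent_weyl S hS
  have hu : ((0, S.symm x) : 𝕍) ∈ ℓY := (mem_prod_bot_top_iff _).2 rfl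
  have hu' : ((x, -S.symm x) : 𝕍) ∈ Submodule.map (((𝐰 * 𝐧 (S : (ι → F) →ₗ[F] (ι → F)) hS * 𝐰 : Spι) :
      𝕍 ≃ₗ[F] 𝕍) : 𝕍 →ₗ[F] 𝕍) ℓY := by
    have := mem_map_weyl_unipotent_weyl (S : (ι → F) →ₗ[F] (ι → F)) hS (S.symm x)
    rwa [LinearEquiv.coe_coe, LinearEquiv.apply_symm_apply] at this
  have hx : ((middleCoord (S : (ι → F) →ₗ[F] (ι → F)) hS x : Submodule.map (((𝐰 * 𝐧 (S : (ι → F) →ₗ[F] (ι → F))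
      hS : Spι) : 𝕍 ≃ₗ[F] 𝕍) : 𝕍 →ₗ[F] 𝕍) ℓY) : 𝕍) = ((0, S.symm x) : 𝕍) + (x, -S.symm x) := by
    show ((x, 0) : 𝕍) = _
    rw [Prod.mk_add_mk, zero_add, add_neg_cancel]
  have hp1 : (Submodule.prod (⊥ : Submodule F (ι → F)) (⊤ : Submodule F (ι → F))).projection _ h
      (((0, S.symm x) : 𝕍) + (x, -S.symm x)) = ((0, S.symm x) : 𝕍) := by
    rw [map_add, Submodule.projection_apply_of_mem_left h hu, Submodule.projection_apply_of_mem_right h hu', add_zero]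
  have hp3 : (Submodule.map (((𝐰 * 𝐧 (S : (ι → F) →ₗ[F] (ι → F)) hS * 𝐰 : Spι) : 𝕍 ≃ₗ[F] 𝕍) :
      𝕍 →ₗ[F] 𝕍) ℓY).projection _ h.symm (((0, S.symm x) : 𝕍) + (x, -S.symm x)) = ((x, -S.symm x) : 𝕍) := by
    rw [map_add, Submodule.projection_apply_of_mem_right h.symm hu, Submodule.projection_apply_of_mem_left h.symm hu',
      zero_add]
  rw [transverseForm_apply, hx, hp1, hp3, alt_polar_dotProductBilin_apply]
  simp

omit [ValuativeRel F] [TopologicalSpace F] [IsNonarchimedeanLocalField F] [MeasurableSpace F] [BorelSpace F] in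
/-- the quadratic form `x ↦ -⟨x, S⁻¹x⟩` pulled back: it is `(2 · (-q_S)) ∘ S⁻¹`, `-q_S(x) = -½⟨x, Sx⟩`.
[cite: Rangarao1993, Thm 4.1 (4), p. 358] -/
theorem transverseForm_comp_middleCoord (S : (ι → F) ≃ₗ[F] (ι → F))
    (hS : ∀ x x' : ι → F, dotProductBilin F F x (S x') = dotProductBilin F F x' (S x)) :
    (transverseForm 𝔸 ℓY (Submodule.map (((𝐰 * 𝐧 (S : (ι → F) →ₗ[F] (ι → F)) hS : Spι) : 𝕍 ≃ₗ[F] 𝕍) :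
        𝕍 →ₗ[F] 𝕍) ℓY)
      (Submodule.map (((𝐰 * 𝐧 (S : (ι → F) →ₗ[F] (ι → F)) hS * 𝐰 : Spι) : 𝕍 ≃ₗ[F] 𝕍) : 𝕍 →ₗ[F] 𝕍) ℓY)
      (isCompl_prod_bot_top_map_weyl_unipotent_weyl S hS)).comp
        ((middleCoord (S : (ι → F) →ₗ[F] (ι → F)) hS : (ι → F) ≃ₗ[F] _) : (ι → F) →ₗ[F] _) =
      ((2 : F) • negHalfQF (S : (ι → F) →ₗ[F] (ι → F))).comp ((S.symm : (ι → F) ≃ₗ[F] (ι → F)) :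
        (ι → F) →ₗ[F] (ι → F)) := by
  refine QuadraticMap.ext fun x => ?_
  rw [QuadraticMap.comp_apply, LinearEquiv.coe_coe, transverseForm_weyl_unipotent S hS x,
    QuadraticMap.comp_apply, QuadraticMap.smul_apply, negHalfQF_apply, halfForm_apply, LinearEquiv.coe_coe,
    LinearEquiv.coe_coe, LinearEquiv.apply_symm_apply, smul_eq_mul, dotProduct_comm (S.symm x) x, mul_neg,
    ← mul_assoc, mul_invOf_self, one_mul]

omit [ValuativeRel F] [TopologicalSpace F] [IsNonarchimedeanLocalField F] [Invertible (2 : F)] [MeasurableSpace F]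
  [BorelSpace F] in
/-- `⬝ᵥ`-form of the symmetry of `S`. [cite: Weil1964, n° 6, p. 151] -/
private theorem dot_symm_of (S : (ι → F) →ₗ[F] (ι → F))
    (hS : ∀ x x' : ι → F, dotProductBilin F F x (S x') = dotProductBilin F F x' (S x)) :
    ∀ x y : ι → F, x ⬝ᵥ S y = y ⬝ᵥ S x := fun x y => by
  simpa only [dotProductBilin_apply_apply] using hS x y

/-- **THE VALUE OF THE LERAY COCYCLE ON THE WEYL–UNIPOTENT PAIR**: for `S` symmetric invertible,
`c_{ℓ_Y}^ψ(w n(S), w) = γ_{ψ₂}(-½⟨x, Sx⟩)` with `ψ₂ = ψ(2·)` — i.e. `c_{ℓ_Y}^{ψ(½·)}(w n(S), w) = γ_ψ(-q_S)`,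
Rao's "`c(τ u_ρ, τ) =` Weil index of `χ(½⟨x, xρ⟩)`" (the tree's Leray index being that of Kashiwara's form, without
the `½`). [cite: Rangarao1993, Thm 4.1 (4), p. 358; LionVergne1980, §1.5.4, §1.6.13] -/
theorem lerayCocycle_weyl_unipotent (hψ : ψ.IsContinuousNontrivial) (S : (ι → F) ≃ₗ[F] (ι → F))
    (hS : ∀ x x' : ι → F, dotProductBilin F F x (S x') = dotProductBilin F F x' (S x)) :
    lerayCocycle ψ μ 𝔸 ℓY ((𝐰 * 𝐧 (S : (ι → F) →ₗ[F] (ι → F)) hS : Spι) : 𝕍 ≃ₗ[F] 𝕍) ((𝐰 : Spι) : 𝕍 ≃ₗ[F] 𝕍) =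
      weilIndexQF (ψ.mulShift 2) μ (negHalfQF (S : (ι → F) →ₗ[F] (ι → F))) := by
  have h2 : (2 : F) ≠ 0 := Invertible.ne_zero 2
  have hSd := dot_symm_of (S : (ι → F) →ₗ[F] (ι → F)) hS
  have hℓ : ∀ x ∈ ℓY, ∀ y ∈ ℓY, 𝔸 x y = 0 := isotropic_of_orthogonal_eq_self orthogonal_prod_bot_top
  have h3 := isotropic_map hℓ ((𝐰 * 𝐧 (S : (ι → F) →ₗ[F] (ι → F)) hS * 𝐰 : Spι) : 𝕍 ≃ₗ[F] 𝕍) (sp_isometry _)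
  rw [lerayCocycle_def, ← Subgroup.coe_mul,
    lerayWeilIndex_eq_weilIndexSpace_transverseForm μ hψ isAlt_alt_polar_dotProductBilin
      (isCompl_prod_bot_top_map_weyl_unipotent_weyl S hS) hℓ h3,
    ← weilIndexSpace_comp_linearEquiv μ hψ _ (middleCoord (S : (ι → F) →ₗ[F] (ι → F)) hS),
    transverseForm_comp_middleCoord S hS, weilIndexSpace_eq_weilIndexQF' μ hψ, weilIndexQF'_comp_linearEquiv μ hψ,
    weilIndexQF'_smul μ hψ h2 (separatingLeft_associated_negHalfQF S hSd),
    weilIndexQF'_eq_weilIndexQF μ (isContinuousNontrivial_mulShift_of_ne_zero hψ h2)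
      (separatingLeft_associated_negHalfQF S hSd)]

/-! ## §3 Reduction to the Weyl–unipotent pair by bi-`P`-invariance -/

omit [ValuativeRel F] [TopologicalSpace F] [IsNonarchimedeanLocalField F] [MeasurableSpace F] [BorelSpace F] in
/-- `n(c) = n(c')` for `c = c'` (the symmetry witnesses being propositions). [cite: Weil1964, n° 6, p. 151] -/
theorem unipotentSp_congr {c c' : (ι → F) →ₗ[F] (ι → F)} (h : c = c')
    (hc : ∀ x x' : ι → F, dotProductBilin F F x (c x') = dotProductBilin F F x' (c x))
    (hc' : ∀ x x' : ι → F, dotProductBilin F F x (c' x') = dotProductBilin F F x' (c' x)) :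
    (𝐧 c hc : Spι) = 𝐧 c' hc' := by
  subst h; rfl

omit [ValuativeRel F] [TopologicalSpace F] [IsNonarchimedeanLocalField F] [Invertible (2 : F)] [MeasurableSpace F]
  [BorelSpace F] in
/-- `β`-form of the symmetry of `T = ᵗB₂(δ₁ + γ₂)B₂`. [cite: Weil1964, n° 15, p. 163] -/
theorem symm_of_coe_eq' [DecidableEq ι] {γ δ : (ι → F) →ₗ[F] (ι → F)}
    (hδ : ∀ x x' : ι → F, dotProductBilin F F x (δ x') = dotProductBilin F F x' (δ x))
    (hγ : ∀ x x' : ι → F, dotProductBilin F F x (γ x') = dotProductBilin F F x' (γ x))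
    (B₂ Tₑ : (ι → F) ≃ₗ[F] (ι → F))
    (hT : (Tₑ : (ι → F) →ₗ[F] (ι → F)) =
      ((transposePi B₂ : (ι → F) ≃ₗ[F] (ι → F)) : (ι → F) →ₗ[F] (ι → F)) ∘ₗ (δ + γ) ∘ₗ
        ((B₂ : (ι → F) ≃ₗ[F] (ι → F)) : (ι → F) →ₗ[F] (ι → F))) :
    ∀ x x' : ι → F, dotProductBilin F F x ((Tₑ : (ι → F) →ₗ[F] (ι → F)) x') =
      dotProductBilin F F x' ((Tₑ : (ι → F) →ₗ[F] (ι → F)) x) := by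
  rw [hT]; exact symm_transposePi_comp (symm_add hδ hγ) B₂

/-- **REDUCTION `c_{ℓ_Y}(g₁, g₂) = c_{ℓ_Y}(w n(T), w)`** for canonical words `gᵢ = n(γᵢ) m(Bᵢ) w n(δᵢ)` and
`T = ᵗB₂(δ₁ + γ₂)B₂` (bi-`P_{ℓ_Y}`-invariance, `n(c), m(a) ∈ P_{ℓ_Y}`, and `w n(δ₁) n(γ₂) m(B₂) = m(ᵗB₂⁻¹) w n(T)`).
[cite: Rangarao1993, Thm 4.1 (1) and (5), p. 358] -/
theorem lerayCocycle_canonicalWord [DecidableEq ι] (hψ : ψ.IsContinuousNontrivial)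
    (γ₁ δ₁ γ₂ δ₂ : (ι → F) →ₗ[F] (ι → F))
    (hγ₁ : ∀ x x' : ι → F, dotProductBilin F F x (γ₁ x') = dotProductBilin F F x' (γ₁ x))
    (hδ₁ : ∀ x x' : ι → F, dotProductBilin F F x (δ₁ x') = dotProductBilin F F x' (δ₁ x))
    (hγ₂ : ∀ x x' : ι → F, dotProductBilin F F x (γ₂ x') = dotProductBilin F F x' (γ₂ x))
    (hδ₂ : ∀ x x' : ι → F, dotProductBilin F F x (δ₂ x') = dotProductBilin F F x' (δ₂ x))
    (B₁ B₂ Tₑ : (ι → F) ≃ₗ[F] (ι → F))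
    (hT : (Tₑ : (ι → F) →ₗ[F] (ι → F)) =
      ((transposePi B₂ : (ι → F) ≃ₗ[F] (ι → F)) : (ι → F) →ₗ[F] (ι → F)) ∘ₗ (δ₁ + γ₂) ∘ₗ
        ((B₂ : (ι → F) ≃ₗ[F] (ι → F)) : (ι → F) →ₗ[F] (ι → F))) :
    lerayCocycle ψ μ 𝔸 ℓY ((𝐧 γ₁ hγ₁ * 𝐦 B₁ * 𝐰 * 𝐧 δ₁ hδ₁ : Spι) : 𝕍 ≃ₗ[F] 𝕍)
        ((𝐧 γ₂ hγ₂ * 𝐦 B₂ * 𝐰 * 𝐧 δ₂ hδ₂ : Spι) : 𝕍 ≃ₗ[F] 𝕍) =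
      lerayCocycle ψ μ 𝔸 ℓY ((𝐰 * 𝐧 (Tₑ : (ι → F) →ₗ[F] (ι → F)) (symm_of_coe_eq' hδ₁ hγ₂ B₂ Tₑ hT) : Spι) :
        𝕍 ≃ₗ[F] 𝕍) ((𝐰 : Spι) : 𝕍 ≃ₗ[F] 𝕍) := by
  have hTβ := symm_of_coe_eq' hδ₁ hγ₂ B₂ Tₑ hT
  -- the group identity `w n(δ₁) n(γ₂) m(B₂) = m(ᵗB₂⁻¹) w n(T)`
  have hg : (𝐰 * 𝐧 δ₁ hδ₁ * 𝐧 γ₂ hγ₂ * 𝐦 B₂ : Spι) =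
      𝐦 (dualLeviPi B₂) * (𝐰 * 𝐧 (Tₑ : (ι → F) →ₗ[F] (ι → F)) hTβ) := by
    rw [mul_assoc (𝐰 : Spι) (𝐧 δ₁ hδ₁), unipotentSp_mul_unipotentSp, mul_assoc, unipotentSp_mul_leviSp, ← mul_assoc,
      weylSp_mul_leviSp, mul_assoc,
      unipotentSp_congr hT.symm (symm_transposePi_comp (symm_add hδ₁ hγ₂) B₂) hTβ]
  have hg' := congrArg Subtype.val hg
  simp only [Subgroup.coe_mul] at hg' ⊢
  simp only [mul_assoc]
  rw [lerayCocycle_parabolic_mul_left μ hψ _ _ (map_unipotentSp_prod_bot_top γ₁ hγ₁) (sp_isometry _),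
    lerayCocycle_parabolic_mul_left μ hψ _ _ (map_leviSp_prod_bot_top B₁) (sp_isometry _),
    ← lerayCocycle_mul_parabolic_left μ _ _ (map_unipotentSp_prod_bot_top γ₂ hγ₂),
    ← lerayCocycle_mul_parabolic_left μ _ _ (map_leviSp_prod_bot_top B₂),
    lerayCocycle_mul_parabolic_right μ _ _ (map_unipotentSp_prod_bot_top δ₂ hδ₂), hg',
    lerayCocycle_parabolic_mul_left μ hψ _ _ (map_leviSp_prod_bot_top (dualLeviPi B₂)) (sp_isometry _)]

/-- **COROLLARY `c_{ℓ_Y}^ψ(g₁, g₂) = γ_{ψ₂}(-½⟨x, Tx⟩)`** for canonical words with `T = ᵗB₂(δ₁+γ₂)B₂` invertible —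
[Rangarao1993] Thm 4.1 (5) on the big cell ("this formula generalizes one given by Weil when `σ₁, σ₂, σ₁σ₂` belong
to the big Bruhat cell"). [cite: Rangarao1993, Thm 4.1 (5), p. 358 and p. 336] -/
theorem lerayCocycle_canonicalWord_eq_weilIndexQF [DecidableEq ι] (hψ : ψ.IsContinuousNontrivial)
    (γ₁ δ₁ γ₂ δ₂ : (ι → F) →ₗ[F] (ι → F))
    (hγ₁ : ∀ x x' : ι → F, dotProductBilin F F x (γ₁ x') = dotProductBilin F F x' (γ₁ x))
    (hδ₁ : ∀ x x' : ι → F, dotProductBilin F F x (δ₁ x') = dotProductBilin F F x' (δ₁ x))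
    (hγ₂ : ∀ x x' : ι → F, dotProductBilin F F x (γ₂ x') = dotProductBilin F F x' (γ₂ x))
    (hδ₂ : ∀ x x' : ι → F, dotProductBilin F F x (δ₂ x') = dotProductBilin F F x' (δ₂ x))
    (B₁ B₂ Tₑ : (ι → F) ≃ₗ[F] (ι → F))
    (hT : (Tₑ : (ι → F) →ₗ[F] (ι → F)) =
      ((transposePi B₂ : (ι → F) ≃ₗ[F] (ι → F)) : (ι → F) →ₗ[F] (ι → F)) ∘ₗ (δ₁ + γ₂) ∘ₗ
        ((B₂ : (ι → F) ≃ₗ[F] (ι → F)) : (ι → F) →ₗ[F] (ι → F))) :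
    lerayCocycle ψ μ 𝔸 ℓY ((𝐧 γ₁ hγ₁ * 𝐦 B₁ * 𝐰 * 𝐧 δ₁ hδ₁ : Spι) : 𝕍 ≃ₗ[F] 𝕍)
        ((𝐧 γ₂ hγ₂ * 𝐦 B₂ * 𝐰 * 𝐧 δ₂ hδ₂ : Spι) : 𝕍 ≃ₗ[F] 𝕍) =
      weilIndexQF (ψ.mulShift 2) μ (negHalfQF (Tₑ : (ι → F) →ₗ[F] (ι → F))) := by
  rw [lerayCocycle_canonicalWord μ hψ γ₁ δ₁ γ₂ δ₂ hγ₁ hδ₁ hγ₂ hδ₂ B₁ B₂ Tₑ hT,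
    lerayCocycle_weyl_unipotent μ hψ Tₑ (symm_of_coe_eq' hδ₁ hγ₂ B₂ Tₑ hT)]

end Value

end Literature.NumberTheory.Weil1964
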